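import Summits.HodgeConjecture.HodgeConjecture.Theorems.Ring2WeilCoverageWeilGramLevel33Principal
import Summits.HodgeConjecture.HodgeConjecture.Theorems.Ring2WeilCoverageWeilGramLevel44Principal
import Summits.HodgeConjecture.HodgeConjecture.Theorems.Ring2WeilCoverageWeilTypeBalance
import Summits.HodgeConjecture.HodgeConjecture.Theorems.Ring2WeilCoverageResidueDictionaryRowsB
import Summits.HodgeConjecture.HodgeConjecture.Theorems.Ring2WeilCoverageCMTypeSignParity
import HarnessLib

/-!
# Weil-type family coverage — the `g = 10` census NO rows `(33, ℚ(√−11))`, `(44, ℚ(√−11))` in their OWN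
# phrasing (`N_K`-balanced CM types), re-proved through van Geemen's SIGN: a second kernel route to the THEOREM-L verdicts

research route conditional on HC_CM; not a corollary; Q11.4-sentence-2 already refuted in dim ≥ 3.

Ring 2, WEIL-TYPE FAMILY-COVERAGE CENSUS (`HOME/WEIL-FAMILY-COVERAGE.md` `## b01`, block b01.49; owner ring2-b01), part 153
of the `Ring2WeilCoverage*` series — the `g = 10` edition of part 117.  The `…Principal` files proved: no principal-type `ζ′` on
`ℤ[ζ_M]` is `Φ`-positive on a CM type of `s`-signature `(5,5)` (the principal Gram determinant has the wrong sign against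
`0 < (−1)^5 det a`, part 92).  The census phrases «Weil type for `K_d`» by the residue set: `Φ` is BALANCED for `N_K`
(`2|S_Φ ∩ N_K| = |S_Φ|`).  The residue dictionary rows of part 27b (`ResidueDictionaryRowsB.nK_…`: `Im φ(s) < 0 ↔ t ∈ N_K`)
and part 28's bridge `two_mul_card_inter_eq_card_iff` turn «`N_K`-balanced» into «`s`-signature `(5,5)`», so:

* **`not_pos_of_principal_thirtyThree_sqrt_neg_eleven`** (`N_K = {2, 7, 8, 10, 13, 17, 19, 28, 29, 32}`, `det a = +164916224`);
* **`not_pos_of_principal_fortyFour_sqrt_neg_eleven`** (`N_K = {7, 13, 17, 19, 21, 29, 35, 39, 41, 43}`, `det a = +164916224`);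

— the statements of the census's NO verdicts at these rows (b01.34/b01.38: no real unit has the required signs), obtained
from the SIGN of `det H` ([vG94 Lemma 5.2 (4)]): two independent kernel routes to the same census cells.

HONEST FRAMING as parts 119–152; `HC_CM` is used nowhere.  No `def`, no named fact, no `sorry`.

References: [cite: vanGeemen1994HodgeAV, Lemma 5.2 (2)–(4)]; [cite: Shimura1998, §14.3 Prop. 4–5, pp. 103–104];
[cite: Aoki2002CMFermatType, §1 (p. 102)] (residue sets of CM types); census b01.34, b01.38, b01.41, b01.49 (seat-derived).
-/

noncomputable section

open Polynomial NumberField Module Complex Finset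
open scoped nonZeroDivisors Real

namespace Summit.HodgeConjecture.Ring2WeilCoverage.WeilGramTenfoldNoPrincipalRows

open Literature.AlgebraicGeometry.Motives (CMType)
open Literature.NumberTheory.ComplexMultiplication
open Summit.HodgeConjecture.Ring2WeilCoverage.WeilTypeBalance (two_mul_card_inter_eq_card_iff)
open Summit.HodgeConjecture.Ring2WeilCoverage.ResidueDictionaryRowsB
  (nK_fortyFour_sqrt_neg_eleven nK_thirtyThree_sqrt_neg_eleven)
open Summit.HodgeConjecture.Ring2WeilCoverage.CMTypeSignParity (card_filter_subtype_eq_ncard im_embedding_ne_zero_of_skew)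

variable {K : Type} [Field K] [NumberField K] {ζ : K}

/-- `𝐞(t) = exp(2πi t/n) ∈ ℂ` (`ZMod.toCircle`). -/
local notation3 (prettyPrint := false) "𝐞 " t:max => ((ZMod.toCircle t : Circle) : ℂ)

open scoped Classical in
/-- **The census NO row `(33, ℚ(√−11))` via van Geemen's sign**: for every CM type `Φ` of `ℚ(ζ_33)` balanced for
`N_K = {2, 7, 8, 10, 13, 17, 19, 28, 29, 32}` (the census's Weil-type condition for `ℚ(√−11)`) and every skew `ζ′` of PRINCIPAL type on
`ℤ[ζ_33]`, `ζ′` is not `Φ`-positive — i.e. `ℂ^Φ/Φ(ℤ[ζ_33])` carries no principal `ι`-compatible polarisation (balanced ⟹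
`s`-signature `(5,5)` by parts 27b/28 ⟹ `Summit.HodgeConjecture.Ring2WeilCoverage.WeilGramLevel33Principal.not_pos_of_principal_sqrtNegEleven`, `det a = +164916224`, the wrong sign).
research route conditional on HC_CM; not a corollary; Q11.4-sentence-2 already refuted in dim ≥ 3. [cite: vanGeemen1994HodgeAV, Lemma 5.2 (4)] [cite: Shimura1998, §14.3 Prop. 4–5, pp. 103–104] -/
theorem not_pos_of_principal_thirtyThree_sqrt_neg_eleven [IsCyclotomicExtension {33} ℚ K] [IsCMField K]
    (hζ : IsPrimitiveRoot ζ 33) (Φ : CMType K)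
    (hbal : 2 * ((Finset.univ.filter fun t : ZMod 33 => ∃ σ ∈ Φ.1, σ ζ = 𝐞 t) ∩
        ({2, 7, 8, 10, 13, 17, 19, 28, 29, 32} : Finset (ZMod 33))).card =
      (Finset.univ.filter fun t : ZMod 33 => ∃ σ ∈ Φ.1, σ ζ = 𝐞 t).card)
    {ζ' : K} (hζ' : IsCMField.complexConj K ζ' = -ζ')
    (hT : CMTypeLattice.IsOfType (1 : (FractionalIdeal (𝓞 K)⁰ K)ˣ) ζ' ⊤) :
    ¬ ∀ φ : Φ.1, 0 < (φ.1 ζ').im := by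
  have hs := Summit.HodgeConjecture.Ring2WeilCoverage.WeilGramLevel33.complexConj_sqrtNegEleven hζ
  have hs0 : ((1 + 2 * (ζ ^ 3 + ζ ^ 9 + ζ ^ 12 + ζ ^ 15 + ζ ^ 27)) : K) ≠ 0 := fun h => by
    have h2 := Summit.HodgeConjecture.Ring2WeilCoverage.WeilGramLevel33.sq_sqrtNegEleven hζ
    rw [h] at h2
    norm_num at h2
  have heq := (two_mul_card_inter_eq_card_iff hζ (1 + 2 * (ζ ^ 3 + ζ ^ 9 + ζ ^ 12 + ζ ^ 15 + ζ ^ 27)) (NK := ({2, 7, 8, 10, 13, 17, 19, 28, 29, 32} : Finset (ZMod 33)))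
    (fun φ t hφ ht => ⟨nK_thirtyThree_sqrt_neg_eleven hφ ht, im_embedding_ne_zero_of_skew hs hs0 φ⟩) Φ).mp hbal
  rw [← card_filter_subtype_eq_ncard Φ (fun ψ => (ψ (1 + 2 * (ζ ^ 3 + ζ ^ 9 + ζ ^ 12 + ζ ^ 15 + ζ ^ 27))).im < 0),
    ← card_filter_subtype_eq_ncard Φ (fun ψ => 0 < (ψ (1 + 2 * (ζ ^ 3 + ζ ^ 9 + ζ ^ 12 + ζ ^ 15 + ζ ^ 27))).im)] at heq
  have hcardΦ : Fintype.card Φ.1 = 10 := by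
    have h := CMTypeLattice.two_mul_card_eq_finrank Φ
    rw [IsCyclotomicExtension.finrank K (cyclotomic.irreducible_rat (by norm_num : 0 < 33))] at h
    have htot : Nat.totient 33 = 20 := by decide
    rw [htot] at h
    omega
  have hsum := Finset.card_filter_add_card_filter_not (s := (Finset.univ : Finset Φ.1))
    (fun φ : Φ.1 => 0 < (φ.1 (1 + 2 * (ζ ^ 3 + ζ ^ 9 + ζ ^ 12 + ζ ^ 15 + ζ ^ 27))).im)
  have hnot : (Finset.univ.filter fun φ : Φ.1 => ¬ 0 < (φ.1 (1 + 2 * (ζ ^ 3 + ζ ^ 9 + ζ ^ 12 + ζ ^ 15 + ζ ^ 27))).im) =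
      Finset.univ.filter fun φ : Φ.1 => (φ.1 (1 + 2 * (ζ ^ 3 + ζ ^ 9 + ζ ^ 12 + ζ ^ 15 + ζ ^ 27))).im < 0 := by
    refine Finset.filter_congr fun φ _ => ?_
    have hne := im_embedding_ne_zero_of_skew hs hs0 φ.1
    exact ⟨fun h => lt_of_le_of_ne (not_lt.mp h) hne, fun h => not_lt.mpr h.le⟩
  rw [hnot, Finset.card_univ, hcardΦ] at hsum
  have hneg : (Finset.univ.filter fun φ : Φ.1 => (φ.1 (1 + 2 * (ζ ^ 3 + ζ ^ 9 + ζ ^ 12 + ζ ^ 15 + ζ ^ 27))).im < 0).card = 5 := by omega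
  have hposc : (Finset.univ.filter fun φ : Φ.1 => 0 < (φ.1 (1 + 2 * (ζ ^ 3 + ζ ^ 9 + ζ ^ 12 + ζ ^ 15 + ζ ^ 27))).im).card = 5 := by omega
  exact Summit.HodgeConjecture.Ring2WeilCoverage.WeilGramLevel33Principal.not_pos_of_principal_sqrtNegEleven hζ Φ hneg hposc hζ' hT

open scoped Classical in
/-- **The census NO row `(44, ℚ(√−11))` via van Geemen's sign**: for every CM type `Φ` of `ℚ(ζ_44)` balanced for
`N_K = {7, 13, 17, 19, 21, 29, 35, 39, 41, 43}` (the census's Weil-type condition for `ℚ(√−11)`) and every skew `ζ′` of PRINCIPAL type on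
`ℤ[ζ_44]`, `ζ′` is not `Φ`-positive — i.e. `ℂ^Φ/Φ(ℤ[ζ_44])` carries no principal `ι`-compatible polarisation (balanced ⟹
`s`-signature `(5,5)` by parts 27b/28 ⟹ `Summit.HodgeConjecture.Ring2WeilCoverage.WeilGramLevel44Principal.not_pos_of_principal_sqrtNegEleven`, `det a = +164916224`, the wrong sign).
research route conditional on HC_CM; not a corollary; Q11.4-sentence-2 already refuted in dim ≥ 3. [cite: vanGeemen1994HodgeAV, Lemma 5.2 (4)] [cite: Shimura1998, §14.3 Prop. 4–5, pp. 103–104] -/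
theorem not_pos_of_principal_fortyFour_sqrt_neg_eleven [IsCyclotomicExtension {44} ℚ K] [IsCMField K]
    (hζ : IsPrimitiveRoot ζ 44) (Φ : CMType K)
    (hbal : 2 * ((Finset.univ.filter fun t : ZMod 44 => ∃ σ ∈ Φ.1, σ ζ = 𝐞 t) ∩
        ({7, 13, 17, 19, 21, 29, 35, 39, 41, 43} : Finset (ZMod 44))).card =
      (Finset.univ.filter fun t : ZMod 44 => ∃ σ ∈ Φ.1, σ ζ = 𝐞 t).card)
    {ζ' : K} (hζ' : IsCMField.complexConj K ζ' = -ζ')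
    (hT : CMTypeLattice.IsOfType (1 : (FractionalIdeal (𝓞 K)⁰ K)ˣ) ζ' ⊤) :
    ¬ ∀ φ : Φ.1, 0 < (φ.1 ζ').im := by
  have hs := Summit.HodgeConjecture.Ring2WeilCoverage.WeilGramLevel44.complexConj_sqrtNegEleven hζ
  have hs0 : ((1 + 2 * (ζ ^ 4 + ζ ^ 12 + ζ ^ 16 + ζ ^ 20 + ζ ^ 36)) : K) ≠ 0 := fun h => by
    have h2 := Summit.HodgeConjecture.Ring2WeilCoverage.WeilGramLevel44.sq_sqrtNegEleven hζ
    rw [h] at h2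
    norm_num at h2
  have heq := (two_mul_card_inter_eq_card_iff hζ (1 + 2 * (ζ ^ 4 + ζ ^ 12 + ζ ^ 16 + ζ ^ 20 + ζ ^ 36)) (NK := ({7, 13, 17, 19, 21, 29, 35, 39, 41, 43} : Finset (ZMod 44)))
    (fun φ t hφ ht => ⟨nK_fortyFour_sqrt_neg_eleven hφ ht, im_embedding_ne_zero_of_skew hs hs0 φ⟩) Φ).mp hbal
  rw [← card_filter_subtype_eq_ncard Φ (fun ψ => (ψ (1 + 2 * (ζ ^ 4 + ζ ^ 12 + ζ ^ 16 + ζ ^ 20 + ζ ^ 36))).im < 0),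
    ← card_filter_subtype_eq_ncard Φ (fun ψ => 0 < (ψ (1 + 2 * (ζ ^ 4 + ζ ^ 12 + ζ ^ 16 + ζ ^ 20 + ζ ^ 36))).im)] at heq
  have hcardΦ : Fintype.card Φ.1 = 10 := by
    have h := CMTypeLattice.two_mul_card_eq_finrank Φ
    rw [IsCyclotomicExtension.finrank K (cyclotomic.irreducible_rat (by norm_num : 0 < 44))] at h
    have htot : Nat.totient 44 = 20 := by decide
    rw [htot] at h
    omega
  have hsum := Finset.card_filter_add_card_filter_not (s := (Finset.univ : Finset Φ.1))
    (fun φ : Φ.1 => 0 < (φ.1 (1 + 2 * (ζ ^ 4 + ζ ^ 12 + ζ ^ 16 + ζ ^ 20 + ζ ^ 36))).im)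
  have hnot : (Finset.univ.filter fun φ : Φ.1 => ¬ 0 < (φ.1 (1 + 2 * (ζ ^ 4 + ζ ^ 12 + ζ ^ 16 + ζ ^ 20 + ζ ^ 36))).im) =
      Finset.univ.filter fun φ : Φ.1 => (φ.1 (1 + 2 * (ζ ^ 4 + ζ ^ 12 + ζ ^ 16 + ζ ^ 20 + ζ ^ 36))).im < 0 := by
    refine Finset.filter_congr fun φ _ => ?_
    have hne := im_embedding_ne_zero_of_skew hs hs0 φ.1
    exact ⟨fun h => lt_of_le_of_ne (not_lt.mp h) hne, fun h => not_lt.mpr h.le⟩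
  rw [hnot, Finset.card_univ, hcardΦ] at hsum
  have hneg : (Finset.univ.filter fun φ : Φ.1 => (φ.1 (1 + 2 * (ζ ^ 4 + ζ ^ 12 + ζ ^ 16 + ζ ^ 20 + ζ ^ 36))).im < 0).card = 5 := by omega
  have hposc : (Finset.univ.filter fun φ : Φ.1 => 0 < (φ.1 (1 + 2 * (ζ ^ 4 + ζ ^ 12 + ζ ^ 16 + ζ ^ 20 + ζ ^ 36))).im).card = 5 := by omega
  exact Summit.HodgeConjecture.Ring2WeilCoverage.WeilGramLevel44Principal.not_pos_of_principal_sqrtNegEleven hζ Φ hneg hposc hζ' hT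

end Summit.HodgeConjecture.Ring2WeilCoverage.WeilGramTenfoldNoPrincipalRows

end
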